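import Mathlib
import Summits.ValiantsHypothesis.ValiantsHypothesis.Theorems.RigidityForcesSymmetryRankRigidMinimalReprLaplaceFiveStarRestrictionRank

/-!
# ValiantsHypothesis / RigidityForcesSymmetry — crux `LaplaceOptimalFive` (stmt-ValiantsHypothesis-24813), crux idea
`young-shadow` (K1) on the star: **(L1) RESTRICTION RANK FOR `|supp λ| = 3` — AT MOST ONE RELATION**
(memo `NOTE-p4g15-24813-K1-star.md` §10: `dim D_ℓ = 1` for `|S| = 3`, `rank ≥ 9`, sharp)

Continuation of ✓ `…RestrictionRank`.  When exactly two coordinates `λ_j = λ_k = 0` vanish, a relation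
`Σ_{a≠b} c_{ab}(x^{{a,b}ᶜ} + E_{ab}) = 0` (`L ∣ E_{ab}`) forces the off-diagonal sum `F = L·G` with `G = g·X_jX_k`
(✓ `squarefree_of_linForm_mul`), hence (`offDiag_relations_of_support_three`):

* `c_{ab} + c_{ba} = 0` for every pair `{a,b}` meeting `{j,k}` (seven pairs), and
* `c_{ab} + c_{ba} = g · Σ_{i∉{a,b}} λ_i` for the three pairs inside `supp λ` — ONE free parameter `g`.

So the ten off-diagonal rows of `Hess m + E` have rank `≥ 9 ≥ 8`.  Also `degree_two_shape` (a degree-2 exponent is `2e_i` or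
`e_i + e_{i'}`).  No definitions, no `sorry`.  Honest framing: (L1) brick, closes nothing; the cases `|supp λ| ≤ 2` and the T2
bound remain; K1-on-the-star PAPER PASS, not kernel; `LaplaceOptimalFive` OPEN · CONTESTED 72/120; `VP ≠ VNP` NOT proved.
-/

set_option linter.dupNamespace false

namespace Summit.ValiantsHypothesis.ValiantsHypothesis.Theorems.RigidityForcesSymmetryRankRigidMinimalRepr

namespace LaplaceFiveStar

open Finset MvPolynomial

/-- A degree-`2` exponent on `Fin 5` is `2e_i` or `e_i + e_{i'}` with `i ≠ i'`. [folklore] -/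
theorem degree_two_shape (d : Fin 5 →₀ ℕ) (hd : d.degree = 2) :
    (∃ i : Fin 5, d = Finsupp.single i 2) ∨ (∃ i i' : Fin 5, i ≠ i' ∧ d = Finsupp.single i 1 + Finsupp.single i' 1) := by
  classical
  have hsum : ∑ k : Fin 5, d k = 2 := by rw [← hd, Finsupp.degree_eq_sum]
  have hle : ∀ k, d k ≤ 2 := fun k => by
    have := Finset.single_le_sum (fun k _ => Nat.zero_le (d k)) (Finset.mem_univ k)
    omega
  by_cases h2 : ∃ i, d i = 2
  · obtain ⟨i, hi⟩ := h2
    refine Or.inl ⟨i, ?_⟩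
    ext k
    by_cases hk : k = i
    · subst hk; simp [hi]
    · rw [Finsupp.single_eq_of_ne hk]
      have h1 : d k + d i ≤ ∑ k : Fin 5, d k := by
        rw [← Finset.sum_pair hk]
        exact Finset.sum_le_sum_of_subset_of_nonneg (Finset.subset_univ _) fun _ _ _ => Nat.zero_le _
      omega
  · simp only [not_exists] at h2
    have hle1 : ∀ k, d k ≤ 1 := fun k => by have := hle k; have := h2 k; omega
    obtain ⟨i, hi⟩ : ∃ i, d i = 1 := by
      by_contra hn
      simp only [not_exists] at hn
      have : ∀ k, d k = 0 := fun k => by have := hle1 k; have := hn k; omega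
      simp [this] at hsum
    obtain ⟨i', hi'i, hi'⟩ : ∃ i', i' ≠ i ∧ d i' = 1 := by
      by_contra hn
      simp only [not_exists, not_and] at hn
      have hrest : ∀ k, k ≠ i → d k = 0 := fun k hk => by have := hle1 k; have := hn k hk; omega
      have : ∑ k : Fin 5, d k = d i := Finset.sum_eq_single i (fun k _ hk => hrest k hk) (by simp)
      omega
    refine Or.inr ⟨i, i', Ne.symm hi'i, ?_⟩
    ext k
    rw [Finsupp.add_apply, Finsupp.single_apply, Finsupp.single_apply]
    by_cases hki : i = k
    · subst hki; simp [hi, hi'i]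
    · by_cases hki' : i' = k
      · subst hki'; simp [hi', hki]
      · rw [if_neg hki, if_neg hki']
        have h3 : d k + d i + d i' ≤ ∑ k : Fin 5, d k := by
          have hsub : ({k, i, i'} : Finset (Fin 5)) ⊆ Finset.univ := Finset.subset_univ _
          have := Finset.sum_le_sum_of_subset_of_nonneg hsub (f := fun k => d k) fun _ _ _ => Nat.zero_le _
          rw [Finset.sum_insert (by simp [Ne.symm hki, Ne.symm hki']), Finset.sum_pair (Ne.symm hi'i)] at this
          simpa [add_assoc] using this
        omega

/-- **Relations for `supp λ = {j,k}ᶜ`.**  With `λ_j = λ_k = 0` (`j ≠ k`) and the other three `λ_i ≠ 0`: a relation among the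
off-diagonal entries of `Hess m + E` (`L ∣ E_{ab}`) vanishes on the seven pairs meeting `{j,k}` and is ONE common multiple `g` of
`Σ_{i∉{a,b}} λ_i` on the three pairs inside the support. [folklore] -/
theorem offDiag_relations_of_support_three (lam : Fin 5 → ℂ) (j k : Fin 5) (hjk : j ≠ k) (hj : lam j = 0) (hk : lam k = 0)
    (hS : ∀ i : Fin 5, i ≠ j → i ≠ k → lam i ≠ 0)
    (E : Fin 5 → Fin 5 → MvPolynomial (Fin 5) ℂ)
    (hE : ∀ a b : Fin 5, a ≠ b → (∑ z : Fin 5, lam z • (X z : MvPolynomial (Fin 5) ℂ)) ∣ E a b)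
    (c : Fin 5 → Fin 5 → ℂ)
    (hrel : ∑ a : Fin 5, ∑ b : Fin 5, (if a = b then 0 else
      C (c a b) * (monomial (Finsupp.equivFunOnFinite.symm (fun z : Fin 5 => if z = a ∨ z = b then (0 : ℕ) else 1)) 1 + E a b))
      = 0) :
    (∀ a b : Fin 5, a ≠ b → (a = j ∨ a = k ∨ b = j ∨ b = k) → c a b + c b a = 0) ∧
    (∃ g : ℂ, ∀ a b : Fin 5, a ≠ b → ¬(a = j ∨ a = k ∨ b = j ∨ b = k) →
      c a b + c b a = g * ∑ i : Fin 5, (if i = a ∨ i = b then 0 else lam i)) := by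
  classical
  set L : MvPolynomial (Fin 5) ℂ := ∑ z : Fin 5, lam z • (X z : MvPolynomial (Fin 5) ℂ) with hL
  set F : MvPolynomial (Fin 5) ℂ := ∑ a : Fin 5, ∑ b : Fin 5, (if a = b then 0 else
      C (c a b) * monomial (Finsupp.equivFunOnFinite.symm (fun z : Fin 5 => if z = a ∨ z = b then (0 : ℕ) else 1)) 1) with hF
  obtain ⟨G, hG⟩ := linForm_dvd_offDiagSum lam E hE c hrel F hF
  -- a non-zero coordinate `z₀ ∉ {j,k}`
  obtain ⟨z₀, hz₀j, hz₀k⟩ : ∃ z₀ : Fin 5, z₀ ≠ j ∧ z₀ ≠ k := by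
    have hc : 0 < ((Finset.univ.erase j).erase k).card := by
      rw [Finset.card_erase_of_mem (by simp [Ne.symm hjk]), Finset.card_erase_of_mem (Finset.mem_univ _)]
      simp
    obtain ⟨z, hz⟩ := Finset.card_pos.mp hc
    simp only [Finset.mem_erase] at hz
    exact ⟨z, hz.2.1, hz.1⟩
  have hz₀ : lam z₀ ≠ 0 := hS z₀ hz₀j hz₀k
  have hL1 : L.IsHomogeneous 1 := Literature.RingTheory.MvPolynomial.isHomogeneous_one_sum_smul_X lam
  have hL0 : L ≠ 0 := by
    intro h0
    have := (Literature.RingTheory.MvPolynomial.sum_smul_X_eq_zero_iff lam).mp h0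
    exact hz₀ (by rw [this]; rfl)
  have hFh := offDiagSum_isHomogeneous c F hF
  have hGh : G.IsHomogeneous 2 := isHomogeneous_of_mul_eq (d := 2) (m := 1) (n := 3) hL1 hL0 hFh (by rw [hG]; ring) rfl
  have hF3 := coeff_offDiagSum_cube c F hF
  have hF21 : ∀ i i' : Fin 5, i ≠ i' → coeff (Finsupp.single i 2 + Finsupp.single i' 1) F = 0 :=
    fun i i' _ => coeff_offDiagSum_sq c F hF i i'
  obtain ⟨hdiag, -⟩ := squarefree_of_linForm_mul lam z₀ hz₀ F G hF3 hF21 hG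
  have hoff := squarefree_of_linForm_mul' lam z₀ hz₀ F G hF3 hF21 hG
  -- `G = g · X_j X_k`
  set g : ℂ := coeff (Finsupp.single j 1 + Finsupp.single k 1) G with hg
  have hGeq : G = monomial (Finsupp.single j 1 + Finsupp.single k 1) g := by
    ext d
    rw [coeff_monomial]
    by_cases hd : d.degree = 2
    · rcases degree_two_shape d hd with ⟨i, rfl⟩ | ⟨i, i', hii', rfl⟩
      · rw [hdiag i, if_neg]
        intro h
        have := congr_arg (fun f : (Fin 5) →₀ ℕ => f i) h
        simp only [Finsupp.add_apply, Finsupp.single_apply] at this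
        split_ifs at this <;> omega
      · by_cases hP : (i = j ∨ i = k) ∧ (i' = j ∨ i' = k)
        · -- `{i,i'} = {j,k}`
          obtain ⟨hi, hi'⟩ := hP
          have hd' : Finsupp.single j 1 + Finsupp.single k 1 = Finsupp.single i 1 + Finsupp.single i' 1 := by
            rcases hi with rfl | rfl
            · rcases hi' with h | rfl
              · exact absurd h.symm hii'
              · rfl
            · rcases hi' with rfl | h
              · rw [add_comm]
              · exact absurd h.symm hii'
          rw [if_pos hd', ← hd', hg]
        · -- one of `i, i'` lies in the support
          have hl : lam i ≠ 0 ∨ lam i' ≠ 0 := by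
            by_cases hi : i = j ∨ i = k
            · have hi' : ¬(i' = j ∨ i' = k) := fun h => hP ⟨hi, h⟩
              simp only [not_or] at hi'
              exact Or.inr (hS i' hi'.1 hi'.2)
            · simp only [not_or] at hi
              exact Or.inl (hS i hi.1 hi.2)
          rw [hoff i i' hii' hl, if_neg]
          intro h
          apply hP
          have ei := congr_arg (fun f : (Fin 5) →₀ ℕ => f i) h
          have ei' := congr_arg (fun f : (Fin 5) →₀ ℕ => f i') h
          simp only [Finsupp.add_apply, Finsupp.single_apply] at ei ei'
          constructor
          · by_contra hn
            simp only [not_or] at hn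
            rw [if_neg (Ne.symm hn.1), if_neg (Ne.symm hn.2)] at ei
            split_ifs at ei
          · by_contra hn
            simp only [not_or] at hn
            rw [if_neg (Ne.symm hn.1), if_neg (Ne.symm hn.2)] at ei'
            split_ifs at ei'
    · rw [hGh.coeff_eq_zero hd, if_neg]
      intro h
      apply hd
      rw [← h, Finsupp.degree_eq_sum]
      simp only [Finsupp.add_apply, Finsupp.single_apply]
      rw [Finset.sum_add_distrib, Finset.sum_ite_eq, Finset.sum_ite_eq]
      simp
  -- coefficients of `F = L · g X_j X_k` at `𝟙_{{a,b}ᶜ}`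
  have key : ∀ a b : Fin 5, a ≠ b → c a b + c b a
      = ∑ z : Fin 5, lam z * (if z ∈ (Finsupp.equivFunOnFinite.symm (fun w : Fin 5 => if w = a ∨ w = b then (0 : ℕ) else 1)).support
          then coeff (Finsupp.equivFunOnFinite.symm (fun w : Fin 5 => if w = a ∨ w = b then (0 : ℕ) else 1) - Finsupp.single z 1)
            (monomial (Finsupp.single j 1 + Finsupp.single k 1) g) else 0) := by
    intro a b hab
    rw [← coeff_offDiagSum_compl c F hF a b hab, hG, hGeq, coeff_linForm_mul]
  -- membership in the support of `𝟙_{{a,b}ᶜ}`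
  have hsupp : ∀ a b z : Fin 5, z ∈ (Finsupp.equivFunOnFinite.symm (fun w : Fin 5 => if w = a ∨ w = b then (0 : ℕ) else 1)).support
      ↔ ¬(z = a ∨ z = b) := by
    intro a b z
    rw [Finsupp.mem_support_iff, compl_exponent_apply]
    split_ifs with h <;> simp [h]
  -- the inner coefficient: `g` iff `{a,b,z} = supp λ`, read at a convenient coordinate
  have inner : ∀ a b z : Fin 5, ¬(z = a ∨ z = b) →
      coeff (Finsupp.equivFunOnFinite.symm (fun w : Fin 5 => if w = a ∨ w = b then (0 : ℕ) else 1) - Finsupp.single z 1)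
        (monomial (Finsupp.single j 1 + Finsupp.single k 1) g)
      = if (Finsupp.single j 1 + Finsupp.single k 1
          = Finsupp.equivFunOnFinite.symm (fun w : Fin 5 => if w = a ∨ w = b then (0 : ℕ) else 1) - Finsupp.single z 1)
        then g else 0 := fun a b z _ => coeff_monomial _ _ _
  refine ⟨fun a b hab habjk => ?_, ⟨g, fun a b hab habjk => ?_⟩⟩
  · -- a pair meeting `{j,k}`: every term vanishes
    rw [key a b hab]
    refine Finset.sum_eq_zero fun z _ => ?_
    by_cases hz : z = a ∨ z = b
    · rw [if_neg ((hsupp a b z).not.mpr (not_not.mpr hz)), mul_zero]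
    · rw [if_pos ((hsupp a b z).mpr hz), inner a b z hz, if_neg, mul_zero]
      intro h
      -- evaluate at the element of `{a,b} ∩ {j,k}`
      have eval : ∀ w : Fin 5, (w = j ∨ w = k) → (w = a ∨ w = b) → False := by
        intro w hw hwab
        have e := congr_arg (fun f : (Fin 5) →₀ ℕ => f w) h
        simp only [Finsupp.add_apply, Finsupp.single_apply, Finsupp.tsub_apply, compl_exponent_apply, if_pos hwab] at e
        rcases hw with rfl | rfl
        · simp at e
        · simp [hjk] at e
      rcases habjk with h' | h' | h' | h'
      · exact eval a (Or.inl h') (Or.inl rfl)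
      · exact eval a (Or.inr h') (Or.inl rfl)
      · exact eval b (Or.inl h') (Or.inr rfl)
      · exact eval b (Or.inr h') (Or.inr rfl)
  · -- a pair inside the support: the term at `z` is `λ_z g` off `{a,b}` (and `λ_z = 0` on `{j,k}`)
    rw [key a b hab, Finset.mul_sum]
    refine Finset.sum_congr rfl fun z _ => ?_
    simp only [not_or] at habjk
    obtain ⟨haj, hak, hbj, hbk⟩ := habjk
    by_cases hz : z = a ∨ z = b
    · rw [if_neg ((hsupp a b z).not.mpr (not_not.mpr hz)), if_pos hz, mul_zero, mul_zero]
    · rw [if_pos ((hsupp a b z).mpr hz), inner a b z hz, if_neg hz]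
      by_cases hzjk : z = j ∨ z = k
      · have hlz : lam z = 0 := by rcases hzjk with rfl | rfl <;> assumption
        rw [hlz, zero_mul, mul_zero]
      · -- `{j,k,a,b,z}` are the five slots: the exponents agree
        simp only [not_or] at hz hzjk
        rw [if_pos, mul_comm]
        ext w
        simp only [Finsupp.add_apply, Finsupp.single_apply, Finsupp.tsub_apply, compl_exponent_apply]
        -- the five distinct letters exhaust `Fin 5`
        have hcover : ∀ w : Fin 5, w = j ∨ w = k ∨ w = a ∨ w = b ∨ w = z := by
          have hc5 : ({j, k, a, b, z} : Finset (Fin 5)).card = 5 := by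
            rw [Finset.card_insert_of_notMem, Finset.card_insert_of_notMem, Finset.card_insert_of_notMem,
              Finset.card_pair (Ne.symm hz.2)]
            · simp [hab, Ne.symm hz.1]
            · simp [Ne.symm hak, Ne.symm hbk, Ne.symm hzjk.2]
            · simp [hjk, Ne.symm haj, Ne.symm hbj, Ne.symm hzjk.1]
          have huniv := Finset.eq_univ_of_card _ (by rw [hc5]; simp)
          intro w
          have hw : w ∈ ({j, k, a, b, z} : Finset (Fin 5)) := by rw [huniv]; exact Finset.mem_univ w
          simpa using hw
        rcases hcover w with hw | hw | hw | hw | hw <;> subst w <;> split_ifs <;> first | rfl | omega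

end LaplaceFiveStar

end Summit.ValiantsHypothesis.ValiantsHypothesis.Theorems.RigidityForcesSymmetryRankRigidMinimalRepr
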